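import Literature.NumberTheory.Sieve.PolymathLcmSums
import Literature.NumberTheory.Sieve.PolymathLcmSumsColouring
import Mathlib.NumberTheory.LSeries.RiemannZeta
import Mathlib.NumberTheory.EulerProduct.DirichletLSeries
import Mathlib.Analysis.SpecialFunctions.Log.Summable
import Mathlib.Analysis.PSeries
import HarnessLib

/-!
# Polymath 8b, Lemma 4.1: the kernel `K` as an absolutely convergent sum and as an Euler product

Trunk: AntSieve / parity.S13.  Part of the proof (fifth layer of the decomposition of the named fact
`Literature.NumberTheory.Sieve.frequently_nth_prime_succ_le_add_polymath`, `H₁ ≤ 246`) of the key asymptotic Lemma 4.1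
of D. H. J. Polymath, *Variants of the Selberg sieve, and bounded intervals containing many primes*,
Res. Math. Sci. 1:12 (2014) = arXiv:1407.4897, p. 12 (the named fact `Literature.NumberTheory.Sieve.moebiusLcmSums_asymptotic`
of `PolymathLcmSums.lean`).  After the Fourier expansion, the sum (multisum) becomes an integral of the
kernel

  `K = ∑_{d, d' : [d_j,d'_j], W coprime} ∏_j μ(d_j)μ(d'_j)/([d_j,d'_j] d_j^{a_j} d'_j^{b_j})`

(`eulerTerm`, `eulerKernel`; exponents `a_j, b_j` with positive real part `σ = 1/log x`).  This file
PROVES, for general exponents of common real part `σ > 0`: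

* `sum_pairBox_eulerTerm`: the Euler factorisation (euler-fac) `∑_{(d,d') supported on P} = ∏_{p ∈ P} K_p`
  over any finite set `P` of primes not dividing `W`, with the exact local factor
  `K_p = 1 + (1/p)∑_j (p^{-a_j}p^{-b_j} - p^{-a_j} - p^{-b_j})` (`localFactor`), from the colouring
  identity of `PolymathLcmSumsColouring.lean`;
* absolute convergence ("`∑ |μ(d_j)μ(d'_j)|/([d_j,d'_j] d_j^{1/log x} d'_j^{1/log x}) = ∏_p (1 + 2p^{-1-1/log x} + p^{-1-2/log x}) ≪ log³ x`"):
  every finite partial sum of `|eulerTerm|` is at most `kernelBound k σ = exp(6k ∑_n n^{-1-σ})`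
  (the constant `6k` rather than `3k` because a general admissible weight only satisfies `|w(p)| ≤ 2/p`)
  (`sum_norm_eulerTerm_le`, via the same Euler identity for the weights `d^{-σ}`), hence
  `summable_norm_eulerTerm`, `hasSum_eulerTerm`, `norm_eulerKernel_le`;
* `tendsto_sum_lcmBox_eulerTerm`: the sums over the boxes `[1,D]^{2k}` (those of `lcmSum`) tend to `K`;
* `tendsto_prod_localFactor`: `∏_{p < N, p ∤ W} K_p → K`, i.e. `K = ∏_{p ∤ W} K_p`.

## References

* D. H. J. Polymath, *Variants of the Selberg sieve, and bounded intervals containing many primes*,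
  Res. Math. Sci. 1 (2014), Art. 12; arXiv:1407.4897, proof of Lemma 4.1, p. 12, (euler-fac).
  [Polymath8b2014]
-/

noncomputable section

open Filter Finset
open scoped BigOperators Topology ArithmeticFunction.Moebius

namespace Literature.NumberTheory.Sieve

namespace LcmEuler

variable {ι : Type*} [Fintype ι] [DecidableEq ι]

/-! ### The Euler factorisation with a general denominator weight -/

section Weighted

variable {P : Finset ℕ} (hP : ∀ q ∈ P, q.Prime)
include hP

/-- The local weight of a colour at the prime `q`, for a general multiplicative denominator weight `w`
(`w = 1/n` recovers `colourWeight`; `w = 1/φ(n)` is the variant "with `φ([d_j,d'_j])` in place of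
`[d_j,d'_j]`" of Lemma 4.1). [cite: Polymath8b2014, Lemma 4.1 (proof, (euler-fac) and last paragraph)] -/
def colourWeightW (g h : ι → ℕ → ℂ) (w : ℕ → ℂ) (q : ℕ) : Colour ι → ℂ
  | none => 1
  | some (j, t) =>
    if t = 0 then g j q * h j q * w q else if t = 1 then g j q * w q else h j q * w q

/-- The summand `∏_j g_j(d_j) h_j(d'_j) w([d_j, d'_j])` (general denominator weight).
[cite: Polymath8b2014, Lemma 4.1 (last paragraph of the proof)] -/
def pairSummandW (g h : ι → ℕ → ℂ) (w : ℕ → ℂ) (t : (ι → ℕ) × (ι → ℕ)) : ℂ :=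
  ∏ j, g j (t.1 j) * h j (t.2 j) * w (Nat.lcm (t.1 j) (t.2 j))

omit [Fintype ι] [DecidableEq ι] hP in
/-- The `none`-fibre contributes `1` (weighted version). [folklore] -/
theorem prod_filter_none_W (g h : ι → ℕ → ℂ) (w : ℕ → ℂ) (c : ↥P → Colour ι) :
    ∏ q ∈ Finset.univ.filter (fun q : ↥P => c q = none), colourWeightW g h w q (c q) = 1 :=
  Finset.prod_eq_one fun q hq => by rw [(Finset.mem_filter.1 hq).2]; rfl

/-- **The summand of a colouring is the product of the local weights (weighted version)**:
`w([d_j,d'_j]) = w(A)w(B)w(C)` for the pairwise coprime parts. [cite: Polymath8b2014, Lemma 4.1 (proof, (euler-fac))] -/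
theorem pairSummandW_colour (g h : ι → ℕ → ℂ) (w : ℕ → ℂ) (hg : ∀ j, IsPrimeProdMult (g j))
    (hh : ∀ j, IsPrimeProdMult (h j)) (hw : IsPrimeProdMult w) (c : ↥P → Colour ι) :
    pairSummandW g h w (colourFst P c, colourSnd P c) = ∏ q : ↥P, colourWeightW g h w q (c q) := by
  set Fb : ι → Fin 3 → Finset ↥P := fun j t => Finset.univ.filter (fun q : ↥P => c q = some (j, t))
    with hFb
  have hpart : ∀ j t, colourPart P c (some (j, t)) = ∏ q ∈ Fb j t, (q : ℕ) := fun j t => rfl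
  have hdisj : ∀ j (a b : Fin 3), a ≠ b → Disjoint (Fb j a) (Fb j b) := by
    intro j a b hab
    rw [hFb, Finset.disjoint_filter]
    intro q _ h1 h2
    rw [h1] at h2
    simp only [Option.some.injEq, Prod.mk.injEq, true_and] at h2
    exact hab h2
  have hj : ∀ j, g j (colourFst P c j) * h j (colourSnd P c j) *
      w (Nat.lcm (colourFst P c j) (colourSnd P c j)) =
      (∏ q ∈ Fb j 0, colourWeightW g h w q (c q)) * (∏ q ∈ Fb j 1, colourWeightW g h w q (c q)) *
        ∏ q ∈ Fb j 2, colourWeightW g h w q (c q) := by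
    intro j
    have hw0 : ∏ q ∈ Fb j 0, colourWeightW g h w q (c q) = ∏ q ∈ Fb j 0, g j q * h j q * w q :=
      Finset.prod_congr rfl fun q hq => by rw [(Finset.mem_filter.1 hq).2]; rfl
    have hw1 : ∏ q ∈ Fb j 1, colourWeightW g h w q (c q) = ∏ q ∈ Fb j 1, g j q * w q :=
      Finset.prod_congr rfl fun q hq => by rw [(Finset.mem_filter.1 hq).2]; rfl
    have hw2 : ∏ q ∈ Fb j 2, colourWeightW g h w q (c q) = ∏ q ∈ Fb j 2, h j q * w q :=
      Finset.prod_congr rfl fun q hq => by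
        rw [(Finset.mem_filter.1 hq).2]
        simp [colourWeightW]
    have hd01 := hdisj j 0 1 (by decide)
    have hd02 := hdisj j 0 2 (by decide)
    have hd12 := hdisj j 1 2 (by decide)
    have hd012 : Disjoint (Fb j 0 ∪ Fb j 1) (Fb j 2) := Finset.disjoint_union_left.2 ⟨hd02, hd12⟩
    rw [hw0, hw1, hw2, lcm_colourFst_colourSnd hP, colourFst, colourSnd, hpart, hpart, hpart,
      ← Finset.prod_union hd01, ← Finset.prod_union hd012, ← Finset.prod_union hd02,
      (hg j).map_prod_coe hP, (hh j).map_prod_coe hP, hw.map_prod_coe hP,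
      Finset.prod_union hd012, Finset.prod_union hd01, Finset.prod_union hd01, Finset.prod_union hd02,
      Finset.prod_mul_distrib, Finset.prod_mul_distrib, Finset.prod_mul_distrib, Finset.prod_mul_distrib]
    ring
  unfold pairSummandW
  simp only
  rw [Finset.prod_congr rfl fun j _ => hj j]
  have hfib : ∏ q : ↥P, colourWeightW g h w q (c q) =
      ∏ o : Colour ι, ∏ q ∈ Finset.univ.filter (fun q : ↥P => c q = o), colourWeightW g h w q (c q) :=
    (Finset.prod_fiberwise Finset.univ c fun q => colourWeightW g h w q (c q)).symm
  rw [hfib, Fintype.prod_option, prod_filter_none_W, one_mul, Fintype.prod_prod_type]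
  refine Finset.prod_congr rfl fun j _ => ?_
  rw [Fin.prod_univ_three]

/-- **The Euler product factorisation, general denominator weight**: for `g_j, h_j, w` multiplicative
over products of distinct primes,
`∑_{(d,d') supported on P, [d_j,d'_j] pairwise coprime} ∏_j g_j(d_j)h_j(d'_j) w([d_j,d'_j])
   = ∏_{p ∈ P} (1 + w(p) ∑_j (g_j(p)h_j(p) + g_j(p) + h_j(p)))`;
with `w = 1/φ` this is the Euler product for the variant of (multisum) "if the denominators `[d_j,d'_j]`
are replaced by `φ([d_j,d'_j])`: the `1/p` term in (kp) is replaced by `1/(p-1)`".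
[cite: Polymath8b2014, Lemma 4.1 (proof, (euler-fac) and last paragraph)] -/
theorem sum_pairBox_filter_eq_prod_weight (g h : ι → ℕ → ℂ) (w : ℕ → ℂ)
    (hg : ∀ j, IsPrimeProdMult (g j)) (hh : ∀ j, IsPrimeProdMult (h j)) (hw : IsPrimeProdMult w) :
    ∑ t ∈ (pairBox ι P).filter PairwiseCoprimeLcm, pairSummandW g h w t =
      ∏ q ∈ P, (1 + w q * ∑ j, (g j q * h j q + g j q + h j q)) := by
  have hprod0 : (∏ q ∈ P, q) ≠ 0 := Finset.prod_ne_zero_iff.2 fun q hq => (hP q hq).ne_zero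
  have hbij : ∑ c : ↥P → Colour ι, pairSummandW g h w (colourFst P c, colourSnd P c) =
      ∑ t ∈ (pairBox ι P).filter PairwiseCoprimeLcm, pairSummandW g h w t := by
    refine Finset.sum_bij (fun c _ => (colourFst P c, colourSnd P c)) ?_ ?_ ?_ (fun _ _ => rfl)
    · intro c _
      simp only [Finset.mem_filter, pairBox, Finset.mem_product, Fintype.mem_piFinset,
        Nat.mem_divisors]
      exact ⟨⟨fun j => ⟨colourFst_dvd_prod hP c j, hprod0⟩, fun j => ⟨colourSnd_dvd_prod hP c j, hprod0⟩⟩,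
        fun i j hij => coprime_lcm_of_ne hP c hij⟩
    · intro c₁ _ c₂ _ heq
      simp only [Prod.mk.injEq] at heq
      exact colour_injective hP heq.1 heq.2
    · intro t ht
      simp only [Finset.mem_filter, pairBox, Finset.mem_product, Fintype.mem_piFinset,
        Nat.mem_divisors] at ht
      obtain ⟨⟨h1, h2⟩, hpw⟩ := ht
      refine ⟨colourOf (P := P) t, Finset.mem_univ _, ?_⟩
      ext j
      · exact colourFst_colourOf hP hpw (fun j => (h1 j).1) j
      · exact colourSnd_colourOf hP hpw (fun j => (h2 j).1) j
  rw [← hbij, Finset.sum_congr rfl fun c _ => pairSummandW_colour hP g h w hg hh hw c]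
  have hps := Finset.prod_univ_sum (fun _ : ↥P => (Finset.univ : Finset (Colour ι)))
    (fun q o => colourWeightW g h w q o)
  rw [Fintype.piFinset_univ] at hps
  rw [← hps, ← Finset.prod_coe_sort P]
  refine Finset.prod_congr rfl fun q _ => ?_
  rw [Fintype.sum_option, Fintype.sum_prod_type]
  simp only [colourWeightW, Fin.sum_univ_three, Fin.isValue]
  simp only [show (1 : Fin 3) = 0 ↔ False by decide, show (2 : Fin 3) = 0 ↔ False by decide,
    show (2 : Fin 3) = 1 ↔ False by decide, if_true, if_false]
  rw [Finset.mul_sum]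
  congr 1
  refine Finset.sum_congr rfl fun j _ => ?_
  ring

end Weighted

/-! ### The weights `μ(d) d^{-s}` and `d^{-σ}` -/

omit [Fintype ι] [DecidableEq ι] in
/-- `(∏_{q ∈ S} q)^z = ∏_{q ∈ S} q^z` for natural numbers. [folklore] -/
theorem natCast_prod_cpow (S : Finset ℕ) (z : ℂ) :
    ((∏ q ∈ S, q : ℕ) : ℂ) ^ z = ∏ q ∈ S, (q : ℂ) ^ z := by
  classical
  induction S using Finset.induction_on with
  | empty => simp
  | insert a S ha ih =>
    rw [Finset.prod_insert ha, Finset.prod_insert ha, Nat.cast_mul, Complex.natCast_mul_natCast_cpow,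
      ih]

omit [Fintype ι] [DecidableEq ι] in
/-- `d ↦ μ(d) d^{-z}` is multiplicative over products of distinct primes. [folklore] -/
theorem isPrimeProdMult_moebius_cpow (z : ℂ) :
    IsPrimeProdMult fun n => (μ n : ℂ) * (n : ℂ) ^ (-z) := by
  intro S hS
  simp only
  rw [ArithmeticFunction.IsMultiplicative.map_prod_of_prime ArithmeticFunction.isMultiplicative_moebius
    S hS, Int.cast_prod, natCast_prod_cpow, ← Finset.prod_mul_distrib]

omit [Fintype ι] [DecidableEq ι] in
/-- `d ↦ d^{-z}` is multiplicative over products of distinct primes. [folklore] -/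
theorem isPrimeProdMult_cpow (z : ℂ) : IsPrimeProdMult fun n => (n : ℂ) ^ (-z) :=
  fun S _ => by simp only; rw [natCast_prod_cpow]

omit [Fintype ι] [DecidableEq ι] in
/-- `d ↦ ‖w d‖` is multiplicative over products of distinct primes when `w` is. [folklore] -/
theorem IsPrimeProdMult.norm {w : ℕ → ℂ} (hw : IsPrimeProdMult w) :
    IsPrimeProdMult fun n => (‖w n‖ : ℂ) := by
  intro S hS
  simp only
  rw [hw S hS, norm_prod, Complex.ofReal_prod]

/-- **Admissible denominator weights** for Lemma 4.1: `w` multiplicative over products of distinct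
primes with `|w(p)| ≤ 2/p` and `|w(p) - 1/p| ≤ 2/p²` at primes.  The lemma is used with `w(n) = 1/n`
(denominators `[d_j,d'_j]`) and with `w(n) = 1/φ(n)` ("The same claim holds if the denominators
`[d_j,d'_j]` are replaced by `φ([d_j,d'_j])` … the only change that occurs is that the `1/p` term in (kp)
is replaced by `1/(p-1)`; but this modification may be absorbed into the `1+O(1/p²)` factor in
(kp-est)"). [cite: Polymath8b2014, Lemma 4.1 (statement and last paragraph of the proof)] -/
structure IsLcmWeight (w : ℕ → ℂ) : Prop where
  /-- multiplicativity over products of distinct primes -/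
  mult : IsPrimeProdMult w
  /-- `|w(p)| ≤ 2/p` -/
  norm_le : ∀ p : ℕ, p.Prime → ‖w p‖ ≤ 2 / p
  /-- `|w(p) - 1/p| ≤ 2/p²` -/
  sub_le : ∀ p : ℕ, p.Prime → ‖w p - (p : ℂ)⁻¹‖ ≤ 2 / (p : ℝ) ^ 2

omit [Fintype ι] [DecidableEq ι] in
/-- The weight `1/n` (denominators `[d_j, d'_j]`). [cite: Polymath8b2014, Lemma 4.1] -/
theorem isLcmWeight_inv : IsLcmWeight fun n => (n : ℂ)⁻¹ where
  mult := fun S _ => by simp only; rw [Nat.cast_prod, Finset.prod_inv_distrib]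
  norm_le := fun p hp => by
    simp only [norm_inv, Complex.norm_natCast]
    rw [inv_eq_one_div]
    exact div_le_div_of_nonneg_right (by norm_num) (Nat.cast_nonneg p)
  sub_le := fun p hp => by simp only [sub_self, norm_zero]; positivity

omit [Fintype ι] [DecidableEq ι] in
/-- `φ(∏_{q ∈ S} q) = ∏_{q ∈ S} φ(q)` for distinct primes. [folklore] -/
theorem totient_prod_primes (S : Finset ℕ) (hS : ∀ q ∈ S, q.Prime) :
    Nat.totient (∏ q ∈ S, q) = ∏ q ∈ S, Nat.totient q := by
  classical
  induction S using Finset.induction_on with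
  | empty => simp
  | insert a S ha ih =>
    have hS' : ∀ q ∈ S, q.Prime := fun q hq => hS q (Finset.mem_insert_of_mem hq)
    rw [Finset.prod_insert ha, Finset.prod_insert ha, Nat.totient_mul, ih hS']
    exact Nat.Coprime.prod_right fun q hq =>
      (Nat.coprime_primes (hS a (Finset.mem_insert_self a S)) (hS' q hq)).2 (fun h => ha (h ▸ hq))

omit [Fintype ι] [DecidableEq ι] in
/-- The weight `1/φ(n)` (denominators `φ([d_j, d'_j])`). [cite: Polymath8b2014, Lemma 4.1 (last paragraph of the proof)] -/
theorem isLcmWeight_totient_inv : IsLcmWeight fun n => ((Nat.totient n : ℕ) : ℂ)⁻¹ where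
  mult := fun S hS => by
    simp only
    rw [totient_prod_primes S hS, Nat.cast_prod, Finset.prod_inv_distrib]
  norm_le := fun p hp => by
    simp only [norm_inv, Complex.norm_natCast, Nat.totient_prime hp]
    have hp2 : (2 : ℝ) ≤ p := by exact_mod_cast hp.two_le
    have h1 : ((p - 1 : ℕ) : ℝ) = (p : ℝ) - 1 := by rw [Nat.cast_sub hp.one_le]; simp
    rw [h1, inv_eq_one_div, div_le_div_iff₀ (by linarith) (by linarith)]
    linarith
  sub_le := fun p hp => by
    simp only [Nat.totient_prime hp]
    have hp2 : (2 : ℝ) ≤ p := by exact_mod_cast hp.two_le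
    have hpc : (p : ℂ) ≠ 0 := by exact_mod_cast hp.ne_zero
    have h1 : (((p - 1 : ℕ) : ℕ) : ℂ) = (p : ℂ) - 1 := by push_cast [Nat.cast_sub hp.one_le]; ring
    have hp1 : (p : ℂ) - 1 ≠ 0 := sub_ne_zero.2 (by exact_mod_cast hp.one_lt.ne')
    rw [h1]
    have e : ((p : ℂ) - 1)⁻¹ - (p : ℂ)⁻¹ = ((p : ℂ) * ((p : ℂ) - 1))⁻¹ := by field_simp; ring
    rw [e, norm_inv, norm_mul, Complex.norm_natCast]
    have hn : ‖(p : ℂ) - 1‖ = (p : ℝ) - 1 := by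
      have : ((p : ℂ) - 1) = (((p : ℝ) - 1 : ℝ) : ℂ) := by push_cast; ring
      rw [this, Complex.norm_real, Real.norm_eq_abs, abs_of_pos (by linarith)]
    rw [hn, inv_eq_one_div, div_le_div_iff₀ (by nlinarith) (by positivity)]
    nlinarith

/-! ### The terms `K`-summands and the local factors `K_p` -/

/-- The summand of the kernel `K(ξ_1,…,ξ'_k)` of Polymath 8b (p. 12):
`∏_j μ(d_j) μ(d'_j) w([d_j,d'_j]) / (d_j^{a_j} d'_j^{b_j})` if the `[d_j,d'_j]` are coprime to each other
and to `W`, and `0` otherwise (exponents `a_j = (1+iξ_j)/log x`, `b_j = (1+iξ'_j)/log x` in the paper;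
here arbitrary; denominator weight `w = 1/n` or `1/φ(n)`, see `IsLcmWeight`). [cite: Polymath8b2014, Lemma 4.1 (proof, definition of K)] -/
def eulerTerm (w : ℕ → ℂ) (W : ℕ) (a b : ι → ℂ) (t : (ι → ℕ) × (ι → ℕ)) : ℂ :=
  if LcmCoprime W t.1 t.2 then
    pairSummandW (fun j n => (μ n : ℂ) * (n : ℂ) ^ (-a j)) (fun j n => (μ n : ℂ) * (n : ℂ) ^ (-b j)) w t
  else 0

/-- The kernel `K(ξ_1,…,ξ_k,ξ'_1,…,ξ'_k) := ∑_{d, d' : [d_j,d'_j], W coprime} ∏_j μ(d_j)μ(d'_j)/([d_j,d'_j] d_j^{a_j} d'_j^{b_j})`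
of Polymath 8b p. 12, as an (absolutely convergent, `summable_norm_eulerTerm`) sum over all pairs
of tuples. [cite: Polymath8b2014, Lemma 4.1 (proof, definition of K)] -/
def eulerKernel (w : ℕ → ℂ) (W : ℕ) (a b : ι → ℂ) : ℂ := ∑' t, eulerTerm w W a b t

/-- The Euler factor `K_p = 1 + w(p) ∑_j (p^{-a_j} p^{-b_j} - p^{-a_j} - p^{-b_j})` of (euler-fac)
(the exact value of the printed `K_p`, cf. (kp-est); `w(p) = 1/p` resp. `1/(p-1)`). [cite: Polymath8b2014, Lemma 4.1 (proof, (euler-fac))] -/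
def localFactor (w : ℕ → ℂ) (a b : ι → ℂ) (q : ℕ) : ℂ :=
  1 + w q * ∑ j, ((q : ℂ) ^ (-a j) * (q : ℂ) ^ (-b j) - (q : ℂ) ^ (-a j) - (q : ℂ) ^ (-b j))

/-- The primes `p < N` not dividing `W` (the Euler product of `K` runs over `p ∤ W`, i.e. `p > w`).
[cite: Polymath8b2014, Lemma 4.1 (proof)] -/
def primesBelowNotDvd (W N : ℕ) : Finset ℕ := (Nat.primesBelow N).filter fun q => ¬ q ∣ W

omit [Fintype ι] [DecidableEq ι] in
/-- Members of `primesBelowNotDvd` are prime. [folklore] -/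
theorem prime_of_mem_primesBelowNotDvd {W N q : ℕ} (h : q ∈ primesBelowNotDvd W N) : q.Prime :=
  (Nat.mem_primesBelow.1 (Finset.mem_filter.1 h).1).2

omit [Fintype ι] [DecidableEq ι] in
/-- Members of `primesBelowNotDvd W N` do not divide `W`. [folklore] -/
theorem not_dvd_of_mem_primesBelowNotDvd {W N q : ℕ} (h : q ∈ primesBelowNotDvd W N) : ¬ q ∣ W :=
  (Finset.mem_filter.1 h).2

omit [Fintype ι] [DecidableEq ι] in
/-- Members of `primesBelowNotDvd W N` are `< N`. [folklore] -/
theorem lt_of_mem_primesBelowNotDvd {W N q : ℕ} (h : q ∈ primesBelowNotDvd W N) : q < N :=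
  (Nat.mem_primesBelow.1 (Finset.mem_filter.1 h).1).1

omit [Fintype ι] [DecidableEq ι] in
/-- `primesBelowNotDvd W` is increasing in `N`. [folklore] -/
theorem primesBelowNotDvd_mono (W : ℕ) : Monotone (primesBelowNotDvd W) := by
  intro N M hNM q hq
  refine Finset.mem_filter.2 ⟨Nat.mem_primesBelow.2 ⟨?_, prime_of_mem_primesBelowNotDvd hq⟩,
    not_dvd_of_mem_primesBelowNotDvd hq⟩
  exact lt_of_lt_of_le (lt_of_mem_primesBelowNotDvd hq) hNM

omit [Fintype ι] [DecidableEq ι] in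
/-- A product of distinct primes none of which divides `W` is coprime to `W`. [folklore] -/
theorem coprime_prod_of_forall {P : Finset ℕ} (hP : ∀ q ∈ P, q.Prime) {W : ℕ}
    (hPW : ∀ q ∈ P, ¬ q ∣ W) : Nat.Coprime (∏ q ∈ P, q) W :=
  Nat.Coprime.prod_left fun q hq => (Nat.Prime.coprime_iff_not_dvd (hP q hq)).2 (hPW q hq)

omit [Fintype ι] [DecidableEq ι] in
/-- A product of distinct primes is squarefree. [folklore] -/
theorem squarefree_prod_of_primes {P : Finset ℕ} (hP : ∀ q ∈ P, q.Prime) :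
    Squarefree (∏ q ∈ P, q) := by
  classical
  rw [Nat.squarefree_iff_prime_squarefree]
  intro p hp hdvd
  have heq := eq_prod_filter_of_dvd_prod_primes P hP hdvd
  have hfil : P.filter (· ∣ p * p) = P.filter (· = p) := by
    refine Finset.filter_congr fun q hq => ?_
    constructor
    · intro h
      rcases (Nat.Prime.prime (hP q hq)).dvd_or_dvd h with h | h <;>
        exact (Nat.prime_dvd_prime_iff_eq (hP q hq) hp).1 h
    · rintro rfl; exact dvd_mul_right _ _
  rw [hfil] at heq
  by_cases hpP : p ∈ P
  · rw [Finset.filter_eq' P p, if_pos hpP, Finset.prod_singleton] at heq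
    have : p * p = p * 1 := by rw [mul_one]; exact heq
    have h1 : p = 1 := Nat.eq_of_mul_eq_mul_left hp.pos this
    exact hp.one_lt.ne' h1
  · rw [Finset.filter_eq' P p, if_neg hpP, Finset.prod_empty] at heq
    exact hp.one_lt.ne' (Nat.eq_one_of_mul_eq_one_right heq)

/-- On pairs supported on primes not dividing `W`, the condition `LcmCoprime W` reduces to pairwise
coprimality. [folklore] -/
theorem lcmCoprime_iff_of_mem_pairBox {P : Finset ℕ} (hP : ∀ q ∈ P, q.Prime) {W : ℕ}
    (hPW : ∀ q ∈ P, ¬ q ∣ W) {t : (ι → ℕ) × (ι → ℕ)} (ht : t ∈ pairBox ι P) :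
    LcmCoprime W t.1 t.2 ↔ PairwiseCoprimeLcm t := by
  refine ⟨fun h => h.1, fun h => ⟨h, fun j => ?_⟩⟩
  simp only [pairBox, Finset.mem_product, Fintype.mem_piFinset, Nat.mem_divisors] at ht
  have hl : Nat.lcm (t.1 j) (t.2 j) ∣ ∏ q ∈ P, q := Nat.lcm_dvd (ht.1 j).1 (ht.2 j).1
  exact (coprime_prod_of_forall hP hPW).coprime_dvd_left hl

/-- **(euler-fac) for the kernel of Lemma 4.1**: for a finite set `P` of primes not dividing `W`,
`∑_{(d,d') supported on P} eulerTerm = ∏_{p ∈ P} K_p`. [cite: Polymath8b2014, Lemma 4.1 (proof, (euler-fac))] -/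
theorem sum_pairBox_eulerTerm {w : ℕ → ℂ} (hw : IsLcmWeight w) {P : Finset ℕ} (hP : ∀ q ∈ P, q.Prime)
    {W : ℕ} (hPW : ∀ q ∈ P, ¬ q ∣ W) (a b : ι → ℂ) :
    ∑ t ∈ pairBox ι P, eulerTerm w W a b t = ∏ q ∈ P, localFactor w a b q := by
  have h1 : ∑ t ∈ pairBox ι P, eulerTerm w W a b t =
      ∑ t ∈ (pairBox ι P).filter PairwiseCoprimeLcm,
        pairSummandW (fun j n => (μ n : ℂ) * (n : ℂ) ^ (-a j)) (fun j n => (μ n : ℂ) * (n : ℂ) ^ (-b j)) w t := by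
    rw [Finset.sum_filter]
    refine Finset.sum_congr rfl fun t ht => ?_
    rw [eulerTerm, if_congr (lcmCoprime_iff_of_mem_pairBox hP hPW ht) rfl rfl]
  rw [h1, sum_pairBox_filter_eq_prod_weight hP _ _ _ (fun j => isPrimeProdMult_moebius_cpow (a j))
    (fun j => isPrimeProdMult_moebius_cpow (b j)) hw.mult]
  refine Finset.prod_congr rfl fun q hq => ?_
  rw [localFactor, ArithmeticFunction.moebius_apply_prime (hP q hq)]
  congr 1
  congr 1
  refine Finset.sum_congr rfl fun j _ => ?_
  push_cast
  ring

/-! ### Absolute values: the comparison sum with weights `d^{-σ}` -/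

/-- The summand with all weights replaced by `d^{-σ}`: `∏_j d_j^{-σ} d'_j^{-σ} |w([d_j,d'_j])|`. [folklore] -/
def absSummand (σ : ℝ) (w : ℕ → ℂ) (t : (ι → ℕ) × (ι → ℕ)) : ℝ :=
  ∏ j, (t.1 j : ℝ) ^ (-σ) * (t.2 j : ℝ) ^ (-σ) * ‖w (Nat.lcm (t.1 j) (t.2 j))‖

omit [Fintype ι] [DecidableEq ι] in
/-- `|μ(n) n^{-a}| ≤ n^{-Re a}`. [folklore] -/
theorem norm_moebius_mul_cpow_le (n : ℕ) (a : ℂ) :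
    ‖(μ n : ℂ) * (n : ℂ) ^ (-a)‖ ≤ (n : ℝ) ^ (-a.re) := by
  rcases Nat.eq_zero_or_pos n with rfl | hn
  · simp only [ArithmeticFunction.map_zero, Int.cast_zero, zero_mul, norm_zero]
    exact Real.rpow_nonneg (Nat.cast_nonneg _) _
  · rw [norm_mul, Complex.norm_natCast_cpow_of_pos hn, Complex.neg_re]
    have hμ : ‖(μ n : ℂ)‖ ≤ 1 := by
      rw [Complex.norm_intCast]
      exact_mod_cast ArithmeticFunction.abs_moebius_le_one
    have h0 : 0 ≤ (n : ℝ) ^ (-a.re) := Real.rpow_nonneg (Nat.cast_nonneg n) _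
    calc ‖(μ n : ℂ)‖ * (n : ℝ) ^ (-a.re) ≤ 1 * (n : ℝ) ^ (-a.re) :=
        mul_le_mul_of_nonneg_right hμ h0
      _ = _ := one_mul _

/-- `|eulerTerm| ≤ absSummand σ` on pairwise coprime pairs, and `= 0` otherwise, when all exponents
have real part `σ` ("`∑_{d_j,d'_j} |μ(d_j)μ(d'_j)|/([d_j,d'_j] d_j^{1/log x} d'_j^{1/log x})`", p. 12).
[cite: Polymath8b2014, Lemma 4.1 (proof, p. 12)] -/
theorem norm_eulerTerm_le (w : ℕ → ℂ) {W : ℕ} {a b : ι → ℂ} {σ : ℝ}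
    (hab : ∀ j, (a j).re = σ ∧ (b j).re = σ) (t : (ι → ℕ) × (ι → ℕ)) :
    ‖eulerTerm w W a b t‖ ≤ if PairwiseCoprimeLcm t then absSummand σ w t else 0 := by
  unfold eulerTerm
  split_ifs with h1 h2 h2
  · rw [pairSummandW, absSummand, norm_prod]
    refine Finset.prod_le_prod (fun j _ => norm_nonneg _) fun j _ => ?_
    rw [norm_mul, norm_mul]
    have ha := norm_moebius_mul_cpow_le (t.1 j) (a j)
    have hb := norm_moebius_mul_cpow_le (t.2 j) (b j)
    rw [(hab j).1] at ha; rw [(hab j).2] at hb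
    have h0 : 0 ≤ (t.1 j : ℝ) ^ (-σ) := Real.rpow_nonneg (Nat.cast_nonneg _) _
    exact mul_le_mul_of_nonneg_right (mul_le_mul ha hb (norm_nonneg _) h0) (norm_nonneg _)
  · exact absurd h1.1 h2
  · rw [norm_zero]
    exact Finset.prod_nonneg fun j _ => by positivity
  · simp

omit [DecidableEq ι] in
/-- `absSummand` is the instance `g_j = h_j = d ↦ d^{-σ}` of `pairSummand` (as a real number). [folklore] -/
theorem absSummand_eq_pairSummandW (σ : ℝ) (w : ℕ → ℂ) (t : (ι → ℕ) × (ι → ℕ)) :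
    (absSummand σ w t : ℂ) =
      pairSummandW (fun _ n => (n : ℂ) ^ (-(σ : ℂ))) (fun _ n => (n : ℂ) ^ (-(σ : ℂ)))
        (fun n => (‖w n‖ : ℂ)) t := by
  rw [absSummand, pairSummandW, Complex.ofReal_prod]
  refine Finset.prod_congr rfl fun j _ => ?_
  have h1 : (((t.1 j : ℝ) ^ (-σ) : ℝ) : ℂ) = (t.1 j : ℂ) ^ (-(σ : ℂ)) := by
    rw [Complex.ofReal_cpow (Nat.cast_nonneg _)]; push_cast; rfl
  have h2 : (((t.2 j : ℝ) ^ (-σ) : ℝ) : ℂ) = (t.2 j : ℂ) ^ (-(σ : ℂ)) := by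
    rw [Complex.ofReal_cpow (Nat.cast_nonneg _)]; push_cast; rfl
  push_cast
  rw [h1, h2]

/-- **The absolute Euler product**: `∑_{(d,d') supported on P, pairwise coprime} ∏_j d_j^{-σ}d'_j^{-σ}/[d_j,d'_j]
  = ∏_{p ∈ P} (1 + k (p^{-σ}p^{-σ} + 2p^{-σ})/p)` ("`∏_p (1 + 2/p^{1+1/log x} + 1/p^{1+2/log x})`", p. 12).
[cite: Polymath8b2014, Lemma 4.1 (proof, p. 12)] -/
theorem sum_absSummand_eq {w : ℕ → ℂ} (hw : IsLcmWeight w) {P : Finset ℕ} (hP : ∀ q ∈ P, q.Prime)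
    (σ : ℝ) :
    ∑ t ∈ (pairBox ι P).filter PairwiseCoprimeLcm, absSummand σ w t =
      ∏ q ∈ P, (1 + ‖w q‖ * (Fintype.card ι * ((q : ℝ) ^ (-σ) * (q : ℝ) ^ (-σ) + 2 * (q : ℝ) ^ (-σ)))) := by
  apply Complex.ofReal_injective
  push_cast
  rw [Finset.sum_congr rfl fun t _ => absSummand_eq_pairSummandW σ w t,
    sum_pairBox_filter_eq_prod_weight hP _ _ _ (fun _ => isPrimeProdMult_cpow σ)
      (fun _ => isPrimeProdMult_cpow σ) hw.mult.norm]
  refine Finset.prod_congr rfl fun q hq => ?_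
  have hq0 : (0 : ℝ) ≤ q := Nat.cast_nonneg q
  have hc : (((q : ℝ) ^ (-σ) : ℝ) : ℂ) = (q : ℂ) ^ (-(σ : ℂ)) := by
    rw [Complex.ofReal_cpow hq0]; push_cast; rfl
  rw [hc, Finset.sum_const, Finset.card_univ, nsmul_eq_mul]
  ring

/-- The local absolute factor is at most `exp(6k p^{-1-σ})` when `|w(p)| ≤ 2/p`. [folklore] -/
theorem one_add_le_exp_local {q : ℕ} (hq : 2 ≤ q) {σ : ℝ} (hσ : 0 ≤ σ) (k : ℕ) {om : ℝ}
    (hom : om ≤ 2 / q) :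
    1 + om * (k * ((q : ℝ) ^ (-σ) * (q : ℝ) ^ (-σ) + 2 * (q : ℝ) ^ (-σ))) ≤
      Real.exp (6 * k * (q : ℝ) ^ (-(1 + σ))) := by
  have hq1 : (1 : ℝ) ≤ q := by exact_mod_cast (by omega : 1 ≤ q)
  have hqpos : (0 : ℝ) < q := by linarith
  have hpow : (q : ℝ) ^ (-σ) ≤ 1 := Real.rpow_le_one_of_one_le_of_nonpos hq1 (by linarith)
  have hpow0 : 0 ≤ (q : ℝ) ^ (-σ) := Real.rpow_nonneg hqpos.le _
  have hsplit : (q : ℝ) ^ (-(1 + σ)) = (q : ℝ) ^ (-σ) / q := by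
    rw [neg_add, Real.rpow_add hqpos, Real.rpow_neg_one, div_eq_mul_inv]; ring
  have hk : (0 : ℝ) ≤ k := Nat.cast_nonneg k
  set A : ℝ := (q : ℝ) ^ (-σ) with hA
  have h3 : A * A + 2 * A ≤ 3 * A := by nlinarith
  calc 1 + om * (k * (A * A + 2 * A)) ≤ 1 + (2 / q) * (k * (3 * A)) := by
        gcongr
    _ = 6 * k * (A / q) + 1 := by ring
    _ ≤ Real.exp (6 * k * (A / q)) := Real.add_one_le_exp _
    _ = Real.exp (6 * k * (q : ℝ) ^ (-(1 + σ))) := by rw [hsplit]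

/-- The comparison series `∑_n n^{-1-σ}` (`= ζ(1+σ)`, finite for `σ > 0`). [folklore] -/
def zetaBoundSum (σ : ℝ) : ℝ := ∑' n : ℕ, (n : ℝ) ^ (-(1 + σ))

omit [Fintype ι] [DecidableEq ι] in
/-- `∑ n^{-1-σ} < ∞` for `σ > 0`. [folklore] -/
theorem summable_rpow_neg_one_add {σ : ℝ} (hσ : 0 < σ) :
    Summable fun n : ℕ => (n : ℝ) ^ (-(1 + σ)) :=
  Real.summable_nat_rpow.2 (by linarith)

omit [Fintype ι] [DecidableEq ι] in
/-- `∑ n^{-1-σ} ≥ 0`. [folklore] -/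
theorem zetaBoundSum_nonneg (σ : ℝ) : 0 ≤ zetaBoundSum σ :=
  tsum_nonneg fun n => Real.rpow_nonneg (Nat.cast_nonneg n) _

/-- The uniform bound `exp(6k ζ(1+σ))` for all partial sums of `|eulerTerm|`. [folklore] -/
def kernelBound (k : ℕ) (σ : ℝ) : ℝ := Real.exp (6 * k * zetaBoundSum σ)

omit [Fintype ι] [DecidableEq ι] in
/-- The uniform bound is positive. [folklore] -/
theorem kernelBound_pos (k : ℕ) (σ : ℝ) : 0 < kernelBound k σ := Real.exp_pos _

/-- `∏_{p ∈ P} (1 + |w(p)|·k(p^{-2σ} + 2p^{-σ})) ≤ kernelBound k σ = exp(6k ∑_n n^{-1-σ})` (using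
`|w(p)| ≤ 2/p`; "`≤ ζ(1 + 1/log x)^3`" for `w = 1/p`, `k = 1`, p. 12).
[cite: Polymath8b2014, Lemma 4.1 (proof, p. 12)] -/
theorem prod_local_le_kernelBound {w : ℕ → ℂ} (hw : IsLcmWeight w) {P : Finset ℕ}
    (hP : ∀ q ∈ P, q.Prime) {σ : ℝ} (hσ : 0 < σ) (k : ℕ) :
    ∏ q ∈ P, (1 + ‖w q‖ * (k * ((q : ℝ) ^ (-σ) * (q : ℝ) ^ (-σ) + 2 * (q : ℝ) ^ (-σ)))) ≤
      kernelBound k σ := by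
  have hle : ∀ q ∈ P, 1 + ‖w q‖ * (k * ((q : ℝ) ^ (-σ) * (q : ℝ) ^ (-σ) + 2 * (q : ℝ) ^ (-σ))) ≤
      Real.exp (6 * k * (q : ℝ) ^ (-(1 + σ))) :=
    fun q hq => one_add_le_exp_local (hP q hq).two_le hσ.le k (hw.norm_le q (hP q hq))
  have h0 : ∀ q ∈ P, 0 ≤ 1 + ‖w q‖ * (k * ((q : ℝ) ^ (-σ) * (q : ℝ) ^ (-σ) + 2 * (q : ℝ) ^ (-σ))) :=
    fun q _ => by positivity
  calc _ ≤ ∏ q ∈ P, Real.exp (6 * k * (q : ℝ) ^ (-(1 + σ))) := Finset.prod_le_prod h0 hle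
    _ = Real.exp (6 * k * ∑ q ∈ P, (q : ℝ) ^ (-(1 + σ))) := by
        rw [Finset.mul_sum, Real.exp_sum]
    _ ≤ kernelBound k σ := by
        refine Real.exp_le_exp.2 (mul_le_mul_of_nonneg_left ?_ (by positivity))
        exact (summable_rpow_neg_one_add hσ).sum_le_tsum P fun n _ => Real.rpow_nonneg (Nat.cast_nonneg n) _

/-! ### Support of the terms -/

/-- A non-zero term has squarefree, positive entries, the `[d_j,d'_j]` coprime to each other and to `W`.
[folklore] -/
theorem support_eulerTerm {w : ℕ → ℂ} {W : ℕ} {a b : ι → ℂ} {t : (ι → ℕ) × (ι → ℕ)}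
    (h : eulerTerm w W a b t ≠ 0) :
    LcmCoprime W t.1 t.2 ∧ ∀ j, Squarefree (t.1 j) ∧ Squarefree (t.2 j) := by
  unfold eulerTerm at h
  split_ifs at h with hc
  · refine ⟨hc, fun j => ?_⟩
    rw [pairSummandW] at h
    have hj := Finset.prod_ne_zero_iff.1 h j (Finset.mem_univ j)
    have h1 : (μ (t.1 j) : ℂ) ≠ 0 := by
      intro h0; apply hj; simp [h0]
    have h2 : (μ (t.2 j) : ℂ) ≠ 0 := by
      intro h0; apply hj; simp [h0]
    exact ⟨ArithmeticFunction.moebius_ne_zero_iff_squarefree.1 (by exact_mod_cast h1),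
      ArithmeticFunction.moebius_ne_zero_iff_squarefree.1 (by exact_mod_cast h2)⟩
  · exact absurd rfl h

omit [Fintype ι] [DecidableEq ι] in
/-- A squarefree `d < N` coprime to `W` divides `∏ primesBelowNotDvd W N`. [folklore] -/
theorem dvd_prod_primesBelowNotDvd {W N d : ℕ} (hd : Squarefree d) (hdW : Nat.Coprime d W)
    (hdN : d < N) : d ∣ ∏ q ∈ primesBelowNotDvd W N, q := by
  rw [← Nat.prod_primeFactors_of_squarefree hd]
  refine Finset.prod_dvd_prod_of_subset _ _ _ fun p hp => ?_
  have hpp : p.Prime := Nat.prime_of_mem_primeFactors hp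
  have hpd : p ∣ d := Nat.dvd_of_mem_primeFactors hp
  refine Finset.mem_filter.2 ⟨Nat.mem_primesBelow.2 ⟨?_, hpp⟩, fun hpW => ?_⟩
  · exact lt_of_le_of_lt (Nat.le_of_dvd (Nat.pos_of_ne_zero hd.ne_zero) hpd) hdN
  · have h1 : p ∣ Nat.gcd d W := Nat.dvd_gcd hpd hpW
    rw [Nat.Coprime.gcd_eq_one hdW] at h1
    exact hpp.one_lt.ne' (Nat.dvd_one.1 h1)

/-- The predicate "all entries squarefree and coprime to `W`" (the index set on which the
`primesBelowNotDvd`-boxes are cofinal). [folklore] -/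
def GoodPair (W : ℕ) (t : (ι → ℕ) × (ι → ℕ)) : Prop :=
  ∀ j, Squarefree (t.1 j) ∧ Squarefree (t.2 j) ∧ Nat.Coprime (t.1 j) W ∧ Nat.Coprime (t.2 j) W

/-- Non-zero terms are good pairs. [folklore] -/
theorem goodPair_of_eulerTerm_ne_zero {w : ℕ → ℂ} {W : ℕ} {a b : ι → ℂ} {t : (ι → ℕ) × (ι → ℕ)}
    (h : eulerTerm w W a b t ≠ 0) : GoodPair W t := by
  obtain ⟨hc, hsq⟩ := support_eulerTerm h
  intro j
  refine ⟨(hsq j).1, (hsq j).2, ?_, ?_⟩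
  · exact (hc.2 j).coprime_dvd_left (Nat.dvd_lcm_left _ _)
  · exact (hc.2 j).coprime_dvd_left (Nat.dvd_lcm_right _ _)

/-- A good pair with entries `< N` lies in the box of `primesBelowNotDvd W N`. [folklore] -/
theorem mem_pairBox_of_goodPair {W N : ℕ} {t : (ι → ℕ) × (ι → ℕ)} (ht : GoodPair W t)
    (hN : ∀ j, t.1 j < N ∧ t.2 j < N) : t ∈ pairBox ι (primesBelowNotDvd W N) := by
  have hne : (∏ q ∈ primesBelowNotDvd W N, q) ≠ 0 :=
    Finset.prod_ne_zero_iff.2 fun q hq => (prime_of_mem_primesBelowNotDvd hq).ne_zero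
  simp only [pairBox, Finset.mem_product, Fintype.mem_piFinset, Nat.mem_divisors]
  exact ⟨fun j => ⟨dvd_prod_primesBelowNotDvd (ht j).1 (ht j).2.2.1 (hN j).1, hne⟩,
    fun j => ⟨dvd_prod_primesBelowNotDvd (ht j).2.1 (ht j).2.2.2 (hN j).2, hne⟩⟩

/-- Elements of the box of `primesBelowNotDvd W N` are good pairs. [folklore] -/
theorem goodPair_of_mem_pairBox {W N : ℕ} {t : (ι → ℕ) × (ι → ℕ)}
    (ht : t ∈ pairBox ι (primesBelowNotDvd W N)) : GoodPair W t := by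
  simp only [pairBox, Finset.mem_product, Fintype.mem_piFinset, Nat.mem_divisors] at ht
  have hP : ∀ q ∈ primesBelowNotDvd W N, q.Prime := fun q hq => prime_of_mem_primesBelowNotDvd hq
  have hsq := squarefree_prod_of_primes hP
  have hcop := coprime_prod_of_forall hP (fun q hq => not_dvd_of_mem_primesBelowNotDvd hq)
  intro j
  exact ⟨hsq.squarefree_of_dvd (ht.1 j).1, hsq.squarefree_of_dvd (ht.2 j).1,
    hcop.coprime_dvd_left (ht.1 j).1, hcop.coprime_dvd_left (ht.2 j).1⟩

/-! ### Summability and the uniform bound -/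

/-- **Absolute convergence of `K`, quantitatively**: every finite partial sum of `|eulerTerm|` is at
most `kernelBound k σ = exp(6k ∑_n n^{-1-σ})` ("the resulting expression is absolutely convergent", p. 12).
[cite: Polymath8b2014, Lemma 4.1 (proof, p. 12)] -/
theorem sum_norm_eulerTerm_le {w : ℕ → ℂ} (hw : IsLcmWeight w) {W : ℕ} {a b : ι → ℂ} {σ : ℝ}
    (hσ : 0 < σ) (hab : ∀ j, (a j).re = σ ∧ (b j).re = σ) (u : Finset ((ι → ℕ) × (ι → ℕ))) :
    ∑ t ∈ u, ‖eulerTerm w W a b t‖ ≤ kernelBound (Fintype.card ι) σ := by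
  classical
  -- a bound for the entries occurring in `u`
  set N : ℕ := u.sup (fun t => Finset.univ.sup fun j => max (t.1 j) (t.2 j)) + 1 with hN
  have hNlt : ∀ t ∈ u, ∀ j, t.1 j < N ∧ t.2 j < N := by
    intro t ht j
    have h1 : max (t.1 j) (t.2 j) ≤ Finset.univ.sup fun j => max (t.1 j) (t.2 j) :=
      Finset.le_sup (f := fun j => max (t.1 j) (t.2 j)) (Finset.mem_univ j)
    have h2 : (Finset.univ.sup fun j => max (t.1 j) (t.2 j)) ≤
        u.sup (fun t => Finset.univ.sup fun j => max (t.1 j) (t.2 j)) :=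
      Finset.le_sup (f := fun t => Finset.univ.sup fun j => max (t.1 j) (t.2 j)) ht
    constructor <;> omega
  set P := primesBelowNotDvd W N with hPdef
  have hP : ∀ q ∈ P, q.Prime := fun q hq => prime_of_mem_primesBelowNotDvd hq
  calc ∑ t ∈ u, ‖eulerTerm w W a b t‖
      = ∑ t ∈ u.filter (fun t => eulerTerm w W a b t ≠ 0), ‖eulerTerm w W a b t‖ := by
        rw [Finset.sum_filter]
        refine Finset.sum_congr rfl fun t _ => ?_
        split_ifs with h
        · rfl
        · rw [not_not.1 h, norm_zero]
    _ ≤ ∑ t ∈ (pairBox ι P).filter PairwiseCoprimeLcm, ‖eulerTerm w W a b t‖ := by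
        refine Finset.sum_le_sum_of_subset_of_nonneg (fun t ht => ?_) (fun _ _ _ => norm_nonneg _)
        obtain ⟨htu, hne⟩ := Finset.mem_filter.1 ht
        refine Finset.mem_filter.2 ⟨mem_pairBox_of_goodPair (goodPair_of_eulerTerm_ne_zero hne)
          (hNlt t htu), (support_eulerTerm hne).1.1⟩
    _ ≤ ∑ t ∈ (pairBox ι P).filter PairwiseCoprimeLcm, absSummand σ w t := by
        refine Finset.sum_le_sum fun t ht => ?_
        have h := norm_eulerTerm_le w (W := W) hab t
        rwa [if_pos (Finset.mem_filter.1 ht).2] at h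
    _ = ∏ q ∈ P, (1 + ‖w q‖ * (Fintype.card ι * ((q : ℝ) ^ (-σ) * (q : ℝ) ^ (-σ) + 2 * (q : ℝ) ^ (-σ)))) :=
        sum_absSummand_eq hw hP σ
    _ ≤ kernelBound (Fintype.card ι) σ := prod_local_le_kernelBound hw hP hσ _

/-- `t ↦ |eulerTerm t|` is summable. [cite: Polymath8b2014, Lemma 4.1 (proof, p. 12)] -/
theorem summable_norm_eulerTerm {w : ℕ → ℂ} (hw : IsLcmWeight w) {W : ℕ} {a b : ι → ℂ} {σ : ℝ}
    (hσ : 0 < σ) (hab : ∀ j, (a j).re = σ ∧ (b j).re = σ) :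
    Summable fun t => ‖eulerTerm w W a b t‖ :=
  summable_of_sum_le (fun _ => norm_nonneg _) (sum_norm_eulerTerm_le hw hσ hab)

/-- The kernel is the sum of its terms. [folklore] -/
theorem hasSum_eulerTerm {w : ℕ → ℂ} (hw : IsLcmWeight w) {W : ℕ} {a b : ι → ℂ} {σ : ℝ}
    (hσ : 0 < σ) (hab : ∀ j, (a j).re = σ ∧ (b j).re = σ) :
    HasSum (eulerTerm w W a b) (eulerKernel w W a b) :=
  (summable_norm_eulerTerm hw hσ hab).of_norm.hasSum

/-- `‖∑_{t ∈ u} eulerTerm t‖ ≤ kernelBound k σ = exp(6k ∑_n n^{-1-σ})` for every finite `u`. [folklore] -/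
theorem norm_sum_eulerTerm_le {w : ℕ → ℂ} (hw : IsLcmWeight w) {W : ℕ} {a b : ι → ℂ} {σ : ℝ}
    (hσ : 0 < σ) (hab : ∀ j, (a j).re = σ ∧ (b j).re = σ) (u : Finset ((ι → ℕ) × (ι → ℕ))) :
    ‖∑ t ∈ u, eulerTerm w W a b t‖ ≤ kernelBound (Fintype.card ι) σ :=
  (norm_sum_le _ _).trans (sum_norm_eulerTerm_le hw hσ hab u)

/-- `‖K‖ ≤ kernelBound k σ = exp(6k ∑_n n^{-1-σ})`. [folklore] -/
theorem norm_eulerKernel_le {w : ℕ → ℂ} (hw : IsLcmWeight w) {W : ℕ} {a b : ι → ℂ} {σ : ℝ}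
    (hσ : 0 < σ) (hab : ∀ j, (a j).re = σ ∧ (b j).re = σ) :
    ‖eulerKernel w W a b‖ ≤ kernelBound (Fintype.card ι) σ := by
  rw [eulerKernel]
  refine (norm_tsum_le_tsum_norm (summable_norm_eulerTerm hw hσ hab)).trans ?_
  exact (summable_norm_eulerTerm hw hσ hab).tsum_le_of_sum_le (sum_norm_eulerTerm_le hw hσ hab)

/-! ### Box partial sums and prime partial products converge to `K` -/

/-- **The sum (multisum) over the box `[1,D]^{2k}` tends to `K` as `D → ∞`.**
[cite: Polymath8b2014, Lemma 4.1 (proof, p. 12)] -/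
theorem tendsto_sum_lcmBox_eulerTerm {w : ℕ → ℂ} (hw : IsLcmWeight w) {W : ℕ} {a b : ι → ℂ}
    {σ : ℝ} (hσ : 0 < σ) (hab : ∀ j, (a j).re = σ ∧ (b j).re = σ) :
    Tendsto (fun D : ℕ => ∑ t ∈ lcmBox ι D ×ˢ lcmBox ι D, eulerTerm w W a b t) atTop
      (𝓝 (eulerKernel w W a b)) := by
  classical
  have hsupp : Function.support (eulerTerm w W a b) ⊆
      {t : (ι → ℕ) × (ι → ℕ) | ∀ j, 1 ≤ t.1 j ∧ 1 ≤ t.2 j} := by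
    intro t ht
    simp only [Set.mem_setOf_eq]
    intro j
    obtain ⟨_, hsq⟩ := support_eulerTerm ht
    exact ⟨Nat.pos_of_ne_zero (hsq j).1.ne_zero, Nat.pos_of_ne_zero (hsq j).2.ne_zero⟩
  have hX : HasSum ((eulerTerm w W a b) ∘ (↑) :
      {t : (ι → ℕ) × (ι → ℕ) // ∀ j, 1 ≤ t.1 j ∧ 1 ≤ t.2 j} → ℂ) (eulerKernel w W a b) :=
    (hasSum_subtype_iff_of_support_subset hsupp).2 (hasSum_eulerTerm hw hσ hab)
  -- the boxes as finsets of the subtype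
  set B : ℕ → Finset {t : (ι → ℕ) × (ι → ℕ) // ∀ j, 1 ≤ t.1 j ∧ 1 ≤ t.2 j} := fun D =>
    (lcmBox ι D ×ˢ lcmBox ι D).subtype (fun t => ∀ j, 1 ≤ t.1 j ∧ 1 ≤ t.2 j) with hBdef
  have hBmono : Monotone B := by
    intro D D' hDD' t ht
    simp only [hBdef, Finset.mem_subtype, Finset.mem_product, lcmBox, Fintype.mem_piFinset,
      Finset.mem_Icc] at ht ⊢
    exact ⟨fun j => ⟨(ht.1 j).1, (ht.1 j).2.trans hDD'⟩, fun j => ⟨(ht.2 j).1, (ht.2 j).2.trans hDD'⟩⟩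
  have hBcof : ∀ t : {t : (ι → ℕ) × (ι → ℕ) // ∀ j, 1 ≤ t.1 j ∧ 1 ≤ t.2 j}, ∃ D, t ∈ B D := by
    intro t
    refine ⟨Finset.univ.sup fun j => max (t.1.1 j) (t.1.2 j), ?_⟩
    simp only [hBdef, Finset.mem_subtype, Finset.mem_product, lcmBox, Fintype.mem_piFinset,
      Finset.mem_Icc]
    have hle : ∀ j, max (t.1.1 j) (t.1.2 j) ≤ Finset.univ.sup fun j => max (t.1.1 j) (t.1.2 j) :=
      fun j => Finset.le_sup (f := fun j => max (t.1.1 j) (t.1.2 j)) (Finset.mem_univ j)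
    exact ⟨fun j => ⟨(t.2 j).1, (le_max_left _ _).trans (hle j)⟩,
      fun j => ⟨(t.2 j).2, (le_max_right _ _).trans (hle j)⟩⟩
  have hBtend : Tendsto B atTop atTop := tendsto_atTop_finset_of_monotone hBmono hBcof
  have hX' : Tendsto (fun s : Finset {t : (ι → ℕ) × (ι → ℕ) // ∀ j, 1 ≤ t.1 j ∧ 1 ≤ t.2 j} =>
      ∑ y ∈ s, ((eulerTerm w W a b) ∘ (↑)) y) atTop (𝓝 (eulerKernel w W a b)) := by
    have := hX
    rw [HasSum] at this
    simpa only [SummationFilter.unconditional_filter] using this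
  have key := hX'.comp hBtend
  refine key.congr fun D => ?_
  simp only [Function.comp_def, hBdef]
  rw [Finset.sum_subtype_eq_sum_filter, Finset.filter_true_of_mem]
  intro t ht
  simp only [Finset.mem_product, lcmBox, Fintype.mem_piFinset, Finset.mem_Icc] at ht
  exact fun j => ⟨(ht.1 j).1, (ht.2 j).1⟩

/-- **`K = ∏_{p ∤ W} K_p`**: the Euler products over the primes `p < N`, `p ∤ W` tend to `K`
("This latter expression factorizes as an Euler product `K = ∏_{p ∤ WN} K_p`", p. 12).
[cite: Polymath8b2014, Lemma 4.1 (proof, (euler-fac))] -/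
theorem tendsto_prod_localFactor {w : ℕ → ℂ} (hw : IsLcmWeight w) {W : ℕ} {a b : ι → ℂ} {σ : ℝ}
    (hσ : 0 < σ) (hab : ∀ j, (a j).re = σ ∧ (b j).re = σ) :
    Tendsto (fun N : ℕ => ∏ q ∈ primesBelowNotDvd W N, localFactor w a b q) atTop
      (𝓝 (eulerKernel w W a b)) := by
  classical
  have hsupp : Function.support (eulerTerm w W a b) ⊆ {t : (ι → ℕ) × (ι → ℕ) | GoodPair W t} :=
    fun t ht => goodPair_of_eulerTerm_ne_zero ht
  have hX : HasSum ((eulerTerm w W a b) ∘ (↑) : {t : (ι → ℕ) × (ι → ℕ) // GoodPair W t} → ℂ)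
      (eulerKernel w W a b) :=
    (hasSum_subtype_iff_of_support_subset hsupp).2 (hasSum_eulerTerm hw hσ hab)
  set B : ℕ → Finset {t : (ι → ℕ) × (ι → ℕ) // GoodPair W t} := fun N =>
    (pairBox ι (primesBelowNotDvd W N)).subtype (GoodPair W) with hBdef
  have hBmono : Monotone B := by
    intro N M hNM t ht
    simp only [hBdef, Finset.mem_subtype] at ht ⊢
    have hsub : primesBelowNotDvd W N ⊆ primesBelowNotDvd W M := primesBelowNotDvd_mono W hNM
    have hdvd : (∏ q ∈ primesBelowNotDvd W N, q) ∣ ∏ q ∈ primesBelowNotDvd W M, q :=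
      Finset.prod_dvd_prod_of_subset _ _ _ hsub
    have hne : (∏ q ∈ primesBelowNotDvd W M, q) ≠ 0 :=
      Finset.prod_ne_zero_iff.2 fun q hq => (prime_of_mem_primesBelowNotDvd hq).ne_zero
    simp only [pairBox, Finset.mem_product, Fintype.mem_piFinset, Nat.mem_divisors] at ht ⊢
    exact ⟨fun j => ⟨(ht.1 j).1.trans hdvd, hne⟩, fun j => ⟨(ht.2 j).1.trans hdvd, hne⟩⟩
  have hBcof : ∀ t : {t : (ι → ℕ) × (ι → ℕ) // GoodPair W t}, ∃ N, t ∈ B N := by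
    intro t
    refine ⟨(Finset.univ.sup fun j => max (t.1.1 j) (t.1.2 j)) + 1, ?_⟩
    simp only [hBdef, Finset.mem_subtype]
    refine mem_pairBox_of_goodPair t.2 fun j => ?_
    have hle : max (t.1.1 j) (t.1.2 j) ≤ Finset.univ.sup fun j => max (t.1.1 j) (t.1.2 j) :=
      Finset.le_sup (f := fun j => max (t.1.1 j) (t.1.2 j)) (Finset.mem_univ j)
    constructor <;> omega
  have hBtend : Tendsto B atTop atTop := tendsto_atTop_finset_of_monotone hBmono hBcof
  have hX' : Tendsto (fun s : Finset {t : (ι → ℕ) × (ι → ℕ) // GoodPair W t} =>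
      ∑ y ∈ s, ((eulerTerm w W a b) ∘ (↑)) y) atTop (𝓝 (eulerKernel w W a b)) := by
    have := hX
    rw [HasSum] at this
    simpa only [SummationFilter.unconditional_filter] using this
  have key := hX'.comp hBtend
  refine key.congr fun N => ?_
  simp only [Function.comp_def, hBdef]
  rw [Finset.sum_subtype_eq_sum_filter,
    Finset.filter_true_of_mem (fun t ht => goodPair_of_mem_pairBox (ι := ι) ht)]
  exact sum_pairBox_eulerTerm hw (fun q hq => prime_of_mem_primesBelowNotDvd hq)
    (fun q hq => not_dvd_of_mem_primesBelowNotDvd hq) a b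

end LcmEuler

end Literature.NumberTheory.Sieve
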